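import Summits.Parity.BatemanHorn.Theorems.AlmostPrimeZerosSystemLSDRealSegmentTiltedRoughLaw
import Summits.Parity.BatemanHorn.Theorems.AlmostPrimeZerosSystemLSDRealSegmentRoughKernelReduction
import HarnessLib

/-!
# `SystemLSDRealSegment` (stmt-Parity-11292), line `beta-thinned-root-kernel`: CALIBRATION of the rough-kernel stubs
# in the proved class `k = 1`, `deg f = 1` (lead c9)

The three open stubs of skeleton rev L5b (`stub_roughKernel_{linearPair,quadratic,totalDegree}`) assert, class by class,
that the ROUGH part of the kernel obeys the kernel law up to every `ε` for all small `θ`.  In the one class where the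
kernel law is a theorem — ONE LINEAR polynomial `f = (aX + b)` (`betaKernelLaw_of_natDegree_eq_one`, Selberg–Delange in
arithmetic progressions) — the statements of exactly that shape are PROVED here, for every real `y > 1`:

* `roughKernelLaw_of_natDegree_eq_one` — the rough law (shape of the stubs, `k = 1`, `D = 1`);
* `tiltedRoughLaw_of_natDegree_eq_one` — its tilted form: `θ^{y−1} · E^{(y,θ)}_x[y^{s_f − s_{f,⌊x^θ⌋₊+1}}] → e^{−γ(y−1)}/Γ(y)`,
  i.e. for the integers `m = an + b`, `n ≤ x`, tilted by `y^{(capped number of prime factors ≤ x^θ)}`, the exponential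
  moment of the (capped) number of prime factors `> x^θ` is `e^{−γ(y−1)} θ^{−(y−1)}/Γ(y) + o(1)` (`θ → 0` after `x → ∞`).

So the reshaped open content is calibrated: true in the proved class, with the same universal constant
`e^{−γk(y−1)} D^{y−1} Γ(y)^{−k}`.  Everything is PROVED; no definitions.
-/

open Filter Finset Polynomial
open scoped BigOperators Topology

namespace Summit.Parity.BatemanHorn.Cruxes.SystemLSDRealSegment.BetaThinnedRootKernel

open Literature.NumberTheory.Sieve

noncomputable section

/-- **The rough law in the linear class** (`k = 1`, `deg f = 1`, every real `y > 1`): the statement of the shape of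
the open stubs is a THEOREM here (`betaKernelLaw_of_natDegree_eq_one` + `roughLaw_of_betaKernelLaw` + the smooth bound).
[folklore] -/
theorem roughKernelLaw_of_natDegree_eq_one :
    ∀ f : Fin 1 → ℤ[X], IsBatemanHornSystem f → (f 0).natDegree = 1 →
      ∀ y : ℝ, 1 < y → ∀ ε : ℝ, 0 < ε → ∃ θ₀ : ℝ, 0 < θ₀ ∧ ∀ θ : ℝ, 0 < θ → θ ≤ θ₀ →
        ∀ᶠ x : ℕ in atTop,
          |(∑ n ∈ Finset.range (x + 1), ∑ d ∈ (tuples f n).filter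
              (fun d => x < ∏ i, d i ∧ (∏ i, d i) ∉ Nat.smoothNumbers (⌊(x : ℝ) ^ θ⌋₊ + 1)),
                ∏ i, thinWeight y (d i)) / ((x : ℝ) * Real.log x ^ (((1 : ℕ) : ℝ) * (y - 1))) -
            (eulerFactor f (y : ℂ)).re *
              (Real.exp ((y - 1) * Real.log (∏ i, ((f i).natDegree : ℝ))) * (Real.Gamma y)⁻¹ ^ (1 : ℕ) -
                (Real.Gamma (((1 : ℕ) : ℝ) * (y - 1) + 1))⁻¹)| ≤ ε := by
  intro f hf h0 y hy
  obtain ⟨C, -, hC⟩ := stub_smoothKernel_negligible 1 f hf y hy.le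
  exact roughLaw_of_betaKernelLaw hf hy.le ⟨C, hC⟩ (betaKernelLaw_of_natDegree_eq_one f hf h0 y hy)

/-- **The tilted law of the large prime factors of `an + b`** (`k = 1`, `deg f = 1`, every real `y > 1`): for every
`ε > 0` and all small `θ > 0`, eventually in `x`,
`|θ^{y−1} · Σ_{n≤x} y^{s_f(n)} / Σ_{n≤x} y^{s_{f,⌊x^θ⌋₊+1}(n)} − e^{−γ(y−1)}/Γ(y)| ≤ ε`
(`betaKernelLaw_of_natDegree_eq_one` through `betaKernelLaw_iff_tiltedRoughLaw`; here `D = 1`). [folklore] -/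
theorem tiltedRoughLaw_of_natDegree_eq_one :
    ∀ f : Fin 1 → ℤ[X], IsBatemanHornSystem f → (f 0).natDegree = 1 →
      ∀ y : ℝ, 1 < y → ∀ ε : ℝ, 0 < ε → ∃ θ₀ : ℝ, 0 < θ₀ ∧ ∀ θ : ℝ, 0 < θ → θ ≤ θ₀ → ∀ᶠ x : ℕ in atTop,
        |θ ^ (((1 : ℕ) : ℝ) * (y - 1)) *
            ((∑ n ∈ Finset.range (x + 1), y ^ (∑ i, (((f i).eval (n : ℤ)).toNat.factorization.sum fun _ v => min v 2))) /
              (∑ n ∈ Finset.range (x + 1), y ^ (∑ i, (((f i).eval (n : ℤ)).toNat.factorization.sum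
                fun p v => if p < ⌊(x : ℝ) ^ θ⌋₊ + 1 then min v 2 else 0)))) -
          Real.exp (-(Real.eulerMascheroniConstant * (((1 : ℕ) : ℝ) * (y - 1)))) *
            (Real.exp ((y - 1) * Real.log (∏ i, ((f i).natDegree : ℝ))) * (Real.Gamma y)⁻¹ ^ (1 : ℕ))| ≤ ε := by
  intro f hf h0 y hy
  exact (betaKernelLaw_iff_tiltedRoughLaw hf hy).1 (betaKernelLaw_of_natDegree_eq_one f hf h0 y hy)

end

end Summit.Parity.BatemanHorn.Cruxes.SystemLSDRealSegment.BetaThinnedRootKernel
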